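import Summits.NavierStokesRegularity.NavierStokesRegularity.Theses.TypeTwoEternal
import Summits.NavierStokesRegularity.NavierStokesRegularity.Theorems.TypeIliouvilleNoTypeII.Negative.WithoutLerayHopfFalse
import Literature.Analysis.FluidPDE.VorticityCalculus

/-!
# `PaceCell` (stmt-NavierStokesRegularity-18162): the Leray–Hopf hypothesis is load-bearing

Negative (support) lemma for the crux `TypeTwoEternal.PaceCell` ("no-bullet pace in doubling
cells"), refuter crux-attack at birth. The statement with the single hypothesis
`IsLerayHopfOn T ν 0 (u 0) u` deleted — everything else verbatim — is FALSE. Witness: the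
pressure-driven accelerating uniform stream (parasitic drift of Koch–Nadirashvili–Seregin–Šverák,
Acta Math. 203 (2009), §1; arXiv:0709.3599 p. 3) `u(t,x) = g(t)·e₀`, `p = −g′(t) x₀` with the
NON-Type-I amplitude `g(t) = (1 − t)⁻¹ − 1 = t/(1 − t)` (`ν = T = 1`): it is a classical solution
of unforced NS on `[0,1) × ℝ³` from the datum `0` (rapidly decaying), has no classical
extension past `1`, is not Type I (`√(1−t)·g(t) → ∞`), its weighted speed `g(t)√(T′ − t)` has factor-2
doubling cells of every weight (at `t₀ = 1 − 2η²` relative to the horizon `T′ = 1 − η²`, weight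
`(2η)⁻¹ − η → ∞`), and its vorticity is identically zero — the degenerate "Galilean bullet".
Hence ANY proof of `PaceCell` must use the finite-energy (Leray–Hopf) class quantitatively: the
energy is the only hypothesis separating the crux from this exact solution.
[cite: KochNadirashviliSereginSverak2009, §1 p. 3 (parasitic solutions)]
-/

noncomputable section

namespace Summit.NavierStokesRegularity.NavierStokesRegularity.Theorems.PaceCellNegative

open Set Filter Topology Function
open scoped InnerProductSpace RealInnerProductSpace ContDiff
open Literature.Analysis.FluidPDE
open Summit.NavierStokesRegularity.NavierStokesRegularity.Theorems.RungReynoldsOneNegative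
open Summit.NavierStokesRegularity.NavierStokesRegularity.Theorems.TypeIliouvilleNoTypeIINegative

/-! ## The witness

The witness is the drift `drift g`, `driftP g` of
`Theorems/RungReynoldsOne/Negative/WithoutLerayHopfFalse.lean`
(`u = g(t)·driftDir`, `p = −g′(t)x₀`: classical on `[0,1) × ℝ³` for every amplitude smooth on
`(-∞,1)`, rapidly decaying datum when `g(0) = 0`, no classical extension past `1` when `|g| → ∞`)
with the Type-II amplitude `g(t) = (1 − t)⁻¹ − 1` of
`Theorems/TypeIliouvilleNoTypeII/Negative/WithoutLerayHopfFalse.lean` (written inline as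
`fun s : ℝ => (1 - s)⁻¹ - 1`; `gII_zero`, `gII_contDiffOn`, `one_sub_mul_gII`, `gII_nonneg`,
`tendsto_abs_gII_atTop`, `drift_gII_not_isTypeIBlowup` are reused from there), and the vorticity
of a drift slice vanishes by `curl_eq_zero_of_fderiv_eq_zero`
(`Literature/Analysis/FluidPDE/VorticityCalculus`).
-/

/-! ## The crux without finite energy is false -/

/-- **Load-bearing (finite energy): `PaceCell` verbatim with `IsLerayHopfOn T ν 0 (u 0) u`
deleted is FALSE.** Witness `ν = T = 1`, `u = g(t)e₀`, `p = −g′(t)x₀`, `g(t) = (1−t)⁻¹ − 1`: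
classical on `[0,1) × ℝ³` from the datum `0`, no classical extension past `1`, not Type I; for
any `θ₀, K₀ > 0` put `η = min (1/2) (1/(4K₀))`, `T′ = 1 − η²`, `t₀ = 1 − 2η²`, `x₀ = 0`: the
weight is `g(t₀)η = (2η)⁻¹ − η ≥ (4η)⁻¹ ≥ K₀`, the cell is factor-2 doubling on `[0,T′] × ℝ³`
(`g(t)√(T′−t) ≤ √(T′−t)/(1−t) ≤ (2η)⁻¹ ≤ 2 g(t₀) η` by AM–GM with `1 − t = (T′ − t) + η²`),
yet `curl u(t₀) ≡ 0`, so `θ₀ M² ≤ ν‖curl u(t₀, x)‖ = 0` fails at every `x`.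
[cite: KochNadirashviliSereginSverak2009, §1 p. 3 (parasitic solutions)] -/
theorem paceCell_false_without_LerayHopf :
    ¬ (∀ (ν T : ℝ), 0 < ν → 0 < T →
      ∀ (u : ℝ → EuclideanSpace ℝ (Fin 3) → EuclideanSpace ℝ (Fin 3))
        (p : ℝ → EuclideanSpace ℝ (Fin 3) → ℝ),
      IsClassicalNSSolutionOn (Set.Ico 0 T) ν 0 u p →
      HasRapidSpatialDecay (u 0) →
      ¬ HasSmoothExtensionPast ν 0 u T → ¬ IsTypeIBlowup u T →
      ∃ θ₀ K₀ : ℝ, 0 < θ₀ ∧ 0 < K₀ ∧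
        ∀ T' ∈ Set.Ioo 0 T, ∀ t₀ ∈ Set.Ico 0 T', ∀ x₀ : EuclideanSpace ℝ (Fin 3),
        K₀ ≤ ‖u t₀ x₀‖ * Real.sqrt (T' - t₀) →
        (∀ t ∈ Set.Icc 0 T', ∀ x : EuclideanSpace ℝ (Fin 3),
          ‖u t x‖ * Real.sqrt (T' - t) ≤ 2 * (‖u t₀ x₀‖ * Real.sqrt (T' - t₀))) →
        ∃ x : EuclideanSpace ℝ (Fin 3),
          dist x x₀ ≤ ν / ‖u t₀ x₀‖ ∧ θ₀ * ‖u t₀ x₀‖ ^ 2 ≤ ν * ‖curl (u t₀) x‖) := by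
  intro h
  obtain ⟨θ₀, K₀, hθ, hK, hcell⟩ := h 1 1 one_pos one_pos
    (drift (fun s : ℝ => (1 - s)⁻¹ - 1)) (driftP (fun s : ℝ => (1 - s)⁻¹ - 1))
    (drift_isClassical gII_contDiffOn 1) (drift_rapidDecay gII_zero)
    (drift_not_hasSmoothExtensionPast tendsto_abs_gII_atTop 1) drift_gII_not_isTypeIBlowup
  -- the cell parameters
  set η : ℝ := min (1 / 2) (1 / (4 * K₀)) with hη
  have hη0 : 0 < η := lt_min (by norm_num) (by positivity)
  have hη1 : η ≤ 1 / 2 := min_le_left _ _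
  have hη2 : η ≤ 1 / (4 * K₀) := min_le_right _ _
  have hKη : K₀ * η ≤ 1 / 4 := by
    have := (le_div_iff₀ (by positivity : (0 : ℝ) < 4 * K₀)).1 hη2
    linarith
  have hηsq : η ^ 2 ≤ 1 / 4 := by nlinarith
  have hT' : (1 - η ^ 2) ∈ Set.Ioo (0 : ℝ) 1 := ⟨by nlinarith, by nlinarith⟩
  have ht₀ : (1 - 2 * η ^ 2) ∈ Set.Ico (0 : ℝ) (1 - η ^ 2) := ⟨by nlinarith, by nlinarith⟩
  -- the value M = ‖u t₀ x₀‖ = g(t₀) and the weight M √(T' - t₀) = g(t₀) η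
  have ht₀1 : 1 - 2 * η ^ 2 < (1 : ℝ) := by nlinarith
  have h2η : (1 : ℝ) - (1 - 2 * η ^ 2) = 2 * η ^ 2 := by ring
  have hM : ‖drift (fun s : ℝ => (1 - s)⁻¹ - 1) (1 - 2 * η ^ 2) (0 : EuclideanSpace ℝ (Fin 3))‖ =
      (2 * η ^ 2)⁻¹ - 1 := by
    rw [norm_drift, abs_of_nonneg (gII_nonneg ht₀.1 ht₀1), h2η]
  have hg₀ : ((2 * η ^ 2)⁻¹ - 1) * (2 * η ^ 2) = 1 - 2 * η ^ 2 := by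
    have := one_sub_mul_gII ht₀1
    rw [h2η] at this
    rw [mul_comm]; exact this
  have hg₀nn : 0 ≤ (2 * η ^ 2)⁻¹ - 1 := by
    have := gII_nonneg ht₀.1 ht₀1
    rwa [h2η] at this
  have hsq₀ : Real.sqrt (1 - η ^ 2 - (1 - 2 * η ^ 2)) = η := by
    rw [show (1 : ℝ) - η ^ 2 - (1 - 2 * η ^ 2) = η ^ 2 by ring, Real.sqrt_sq hη0.le]
  -- weight ≥ K₀
  have hweight : K₀ ≤ ‖drift (fun s : ℝ => (1 - s)⁻¹ - 1) (1 - 2 * η ^ 2) (0 : EuclideanSpace ℝ (Fin 3))‖ *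
      Real.sqrt (1 - η ^ 2 - (1 - 2 * η ^ 2)) := by
    rw [hM, hsq₀]
    refine not_lt.mp fun hlt => ?_
    nlinarith [hg₀, hKη, hηsq, hη0, mul_lt_mul_of_pos_right hlt hη0]
  -- factor-2 doubling on [0, T'] × ℝ³
  have hdoubling : ∀ t ∈ Set.Icc (0 : ℝ) (1 - η ^ 2), ∀ x : EuclideanSpace ℝ (Fin 3),
      ‖drift (fun s : ℝ => (1 - s)⁻¹ - 1) t x‖ * Real.sqrt (1 - η ^ 2 - t) ≤
        2 * (‖drift (fun s : ℝ => (1 - s)⁻¹ - 1) (1 - 2 * η ^ 2) (0 : EuclideanSpace ℝ (Fin 3))‖ *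
          Real.sqrt (1 - η ^ 2 - (1 - 2 * η ^ 2))) := by
    intro t ht x
    have ht1 : t < 1 := by nlinarith [ht.2]
    rw [hM, hsq₀, norm_drift, abs_of_nonneg (gII_nonneg ht.1 ht1)]
    set r := Real.sqrt (1 - η ^ 2 - t) with hr
    have hr0 : 0 ≤ r := Real.sqrt_nonneg _
    have hrsq : r ^ 2 = 1 - η ^ 2 - t := Real.sq_sqrt (by linarith [ht.2])
    have hgt : ((1 - t)⁻¹ - 1) * (r ^ 2 + η ^ 2) = t := by
      rw [show r ^ 2 + η ^ 2 = 1 - t by linarith, mul_comm]; exact one_sub_mul_gII ht1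
    have hgtnn : 0 ≤ (1 - t)⁻¹ - 1 := gII_nonneg ht.1 ht1
    -- gII t * r ≤ (2η)⁻¹ ≤ 2 g(t₀) η
    nlinarith [mul_nonneg hgtnn (sq_nonneg (r - η)), mul_nonneg hr0 hη0.le, hgt, hg₀, hηsq,
      mul_nonneg hgtnn hr0, ht.1, ht.2, mul_nonneg hg₀nn hη0.le]
  obtain ⟨x, -, hx⟩ := hcell (1 - η ^ 2) hT' (1 - 2 * η ^ 2) ht₀ 0 hweight hdoubling
  have hcurl : curl (drift (fun s : ℝ => (1 - s)⁻¹ - 1) (1 - 2 * η ^ 2)) x = 0 := by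
    rw [drift_apply]
    exact curl_eq_zero_of_fderiv_eq_zero (fderiv_const_apply _)
  rw [hcurl, norm_zero, mul_zero, hM] at hx
  -- θ₀ g(t₀)² ≤ 0 with θ₀ > 0 and g(t₀) > 0
  have hg₀pos : 0 < (2 * η ^ 2)⁻¹ - 1 := by
    rcases hg₀nn.lt_or_eq with hlt | heq
    · exact hlt
    · exfalso; rw [← heq] at hg₀; nlinarith
  nlinarith [mul_pos hθ (pow_pos hg₀pos 2)]

end Summit.NavierStokesRegularity.NavierStokesRegularity.Theorems.PaceCellNegative

end
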